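import Literature.RingTheory.CohomologyAnnihilator.Basic
import Mathlib.RingTheory.Kaehler.Basic
import Mathlib.RingTheory.TensorProduct.Basic
import Mathlib.Algebra.Category.ModuleCat.ChangeOfRingsExact
import Mathlib.Algebra.Category.ModuleCat.Ext.DimensionShifting
import Mathlib.Algebra.Homology.DerivedCategory.Ext.Linear
import HarnessLib

/-!
# The noether different and annihilation of `Ext¹` (Iyengar–Takahashi §3, after Auslander–Goldman)

Topic: `Literature/RingTheory/CohomologyAnnihilator`. For a commutative algebra `B` over a
commutative ring `A` with multiplication `μ : B ⊗_A B → B`, the **noether different**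
`𝔑(B/A) ⊆ B` is `μ(ann_{B ⊗_A B}(Ker μ))` ([IyengarTakahashi2014, §3], going back to
E. Noether and Auslander–Goldman's "homological different"; in the paper for a not necessarily
commutative `Λ` as the image of `Hom_{Λᵉ}(Λ, Λᵉ) → Hom_{Λᵉ}(Λ, Λ) = Z(Λ)`, "it can be identified
with `μ(ann_{Λᵉ} Ker μ)`"). We vendor the commutative case:

* `noetherDifferent A B` — the ideal `{μ(t) | t ∈ B ⊗_A B, (b ⊗ 1) t = (1 ⊗ b) t ∀ b}`;
  `mem_noetherDifferent_iff_exists_mem_annihilator` identifies it with `μ(ann(Ker μ))`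
  (`Ker μ = KaehlerDifferential.ideal A B` is generated by the `1 ⊗ b - b ⊗ 1`).
* `etaTensor` — Remark 3.1: for such `t` and a `B`-module `P`, the `B`-LINEAR map
  `P → B ⊗_A P`, `p ↦ Σ bᵢ ⊗ cᵢ p` (`t = Σ bᵢ ⊗ cᵢ`), i.e. `P ⊗_B η_x`, whose composite with
  `B ⊗_A P → P` is the homothety `x = μ(t)`.
* `noetherDifferent_mul_smul_ext_eq_zero` — **Lemma 3.2** (commutative case; Wang 1994,
  Prop. 5.9, for commutative rings, with the paper's different proof): for `B`-modules `M`, `N`,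
  `𝔑(B/A) · ann_A Ext¹_A(M, N) ⊆ ann_B Ext¹_B(M, N)`, with `Ext¹_A` of the underlying
  `A`-modules (restriction of scalars).

Proof of Lemma 3.2 as printed, phrased through a projective presentation `0 → K → P → M → 0`
over `B` instead of Yoneda extensions: a class `e = δ(f)`, `f : K → N`; if `a ∈ A` kills
`Ext¹_A(M, N)` then `a f` extends to an `A`-linear `F : P → N` (exactness over `A`); for
`x = μ(t) ∈ 𝔑(B/A)` the map `F' = (B ⊗_A P → N, β ⊗ p ↦ β F(p)) ∘ etaTensor t : P → N` is
`B`-linear and extends `x a f`, so `x a e = δ(x a f) = 0`.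

Deliberately NOT here: the non-commutative (noether algebra) generality; Lemma 3.3,
Proposition 3.4 and Theorem 3.6 (they need syzygies over `B`, `StrongGenerator.lean`);
Lemma 3.5 (separability, Auslander–Goldman Prop. 1.1/4.4).

## References

* S. B. Iyengar, R. Takahashi, *Annihilation of cohomology and strong generation of module
  categories*, IMRN 2016; arXiv:1404.1476 — §3, Remark 3.1, Lemma 3.2. [`IyengarTakahashi2014`]
-/

noncomputable section

open CategoryTheory CategoryTheory.Abelian
open scoped TensorProduct

universe u

namespace Literature.RingTheory.CohomologyAnnihilator

section Ring

variable (A : Type u) [CommRing A] (B : Type u) [CommRing B] [Algebra A B]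

/-- The **noether different** `𝔑(B/A)` of a commutative `A`-algebra `B`: the elements `μ(t)` for
`t ∈ B ⊗_A B` centralising the two `B`-structures, `(b ⊗ 1) t = (1 ⊗ b) t` for all `b ∈ B`
(equivalently `t ∈ ann_{B ⊗_A B}(Ker μ)`, `mem_noetherDifferent_iff_exists_mem_annihilator`),
where `μ : B ⊗_A B → B` is the multiplication. [cite: IyengarTakahashi2014, §3] -/
def noetherDifferent : Ideal B where
  carrier := {x | ∃ t : B ⊗[A] B, (∀ b : B, (b ⊗ₜ[A] (1 : B)) * t = ((1 : B) ⊗ₜ[A] b) * t) ∧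
    Algebra.TensorProduct.lmul' (S := B) A t = x}
  zero_mem' := ⟨0, fun b => by rw [mul_zero, mul_zero], map_zero _⟩
  add_mem' := by
    rintro x y ⟨t, ht, rfl⟩ ⟨t', ht', rfl⟩
    exact ⟨t + t', fun b => by rw [mul_add, mul_add, ht, ht'], map_add _ _ _⟩
  smul_mem' := by
    rintro c x ⟨t, ht, rfl⟩
    refine ⟨(c ⊗ₜ[A] (1 : B)) * t, fun b => ?_, ?_⟩
    · rw [← mul_assoc, mul_comm (b ⊗ₜ[A] (1 : B)), mul_assoc, ht b, ← mul_assoc, ← mul_assoc,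
        mul_comm (c ⊗ₜ[A] (1 : B))]
    · rw [map_mul, Algebra.TensorProduct.lmul'_apply_tmul, mul_one, smul_eq_mul]

variable {A B}

/-- Unfolding of `noetherDifferent`. [cite: IyengarTakahashi2014, §3] -/
theorem mem_noetherDifferent_iff {x : B} :
    x ∈ noetherDifferent A B ↔ ∃ t : B ⊗[A] B,
      (∀ b : B, (b ⊗ₜ[A] (1 : B)) * t = ((1 : B) ⊗ₜ[A] b) * t) ∧
        Algebra.TensorProduct.lmul' (S := B) A t = x :=
  Iff.rfl

/-- The centralising condition `(b ⊗ 1) t = (1 ⊗ b) t ∀ b` says `t ∈ ann_{B ⊗_A B}(Ker μ)`, the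
kernel of the multiplication being generated by the `1 ⊗ b - b ⊗ 1`.
[cite: IyengarTakahashi2014, §3] -/
theorem forall_tmul_one_mul_eq_iff_mem_annihilator {t : B ⊗[A] B} :
    (∀ b : B, (b ⊗ₜ[A] (1 : B)) * t = ((1 : B) ⊗ₜ[A] b) * t) ↔
      t ∈ (KaehlerDifferential.ideal A B).annihilator := by
  rw [Submodule.mem_annihilator]
  constructor
  · intro ht i hi
    have hi' : i ∈ Submodule.span B (Set.range fun s : B => (1 : B) ⊗ₜ[A] s - s ⊗ₜ[A] (1 : B)) := by
      rw [KaehlerDifferential.submodule_span_range_eq_ideal]; exact hi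
    clear hi
    induction hi' using Submodule.span_induction with
    | mem y hy =>
      obtain ⟨b, rfl⟩ := hy
      rw [smul_eq_mul, mul_sub, mul_comm t, mul_comm t, ht b, sub_self]
    | zero => exact smul_zero _
    | add y z _ _ hy hz => rw [smul_add, hy, hz, add_zero]
    | smul c y _ hy =>
      rw [smul_comm, hy, smul_zero]
  · intro ht b
    have h := ht _ (KaehlerDifferential.one_smul_sub_smul_one_mem_ideal A b)
    rw [smul_eq_mul, mul_sub, sub_eq_zero, mul_comm t, mul_comm t] at h
    exact h.symm

/-- `𝔑(B/A) = μ(ann_{B ⊗_A B}(Ker μ))` ("can be identified with `μ(ann_{Λᵉ} Ker μ)`").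
[cite: IyengarTakahashi2014, §3] -/
theorem mem_noetherDifferent_iff_exists_mem_annihilator {x : B} :
    x ∈ noetherDifferent A B ↔ ∃ t ∈ (KaehlerDifferential.ideal A B).annihilator,
      Algebra.TensorProduct.lmul' (S := B) A t = x := by
  simp only [mem_noetherDifferent_iff, forall_tmul_one_mul_eq_iff_mem_annihilator]

/-- `𝔑(B/A) = μ(ann(Ker μ))` as an image ideal. [cite: IyengarTakahashi2014, §3] -/
theorem noetherDifferent_eq_map_annihilator :
    noetherDifferent A B = Ideal.map (Algebra.TensorProduct.lmul' (S := B) A)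
      (KaehlerDifferential.ideal A B).annihilator := by
  ext x
  rw [mem_noetherDifferent_iff_exists_mem_annihilator,
    Ideal.mem_map_iff_of_surjective _ fun y => ⟨y ⊗ₜ 1, by simp⟩]

/-! ## Remark 3.1: the `B`-linear map `P ⊗_B η_x : P → B ⊗_A P` -/

section Eta

variable (t : B ⊗[A] B) (P : Type u) [AddCommGroup P] [Module A P] [Module B P]
  [IsScalarTower A B P]

/-- `b ↦ b • p` as an `A`-linear map `B → P`. [folklore] -/
abbrev smulInto (p : P) : B →ₗ[A] P := (LinearMap.toSpanSingleton B P p).restrictScalars A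

/-- `(id ⊗ f)((b ⊗ 1) t) = b • (id ⊗ f)(t)`. [folklore] -/
theorem lTensor_tmul_one_mul {Q : Type u} [AddCommGroup Q] [Module A Q] (f : B →ₗ[A] Q) (b : B) :
    f.lTensor B ((b ⊗ₜ[A] (1 : B)) * t) = b • f.lTensor B t := by
  induction t using TensorProduct.induction_on with
  | zero => rw [mul_zero, map_zero, smul_zero]
  | tmul β γ =>
    rw [Algebra.TensorProduct.tmul_mul_tmul, one_mul, LinearMap.lTensor_tmul,
      LinearMap.lTensor_tmul, TensorProduct.smul_tmul', smul_eq_mul]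
  | add y z hy hz => rw [mul_add, map_add, map_add, hy, hz, smul_add]

/-- `(id ⊗ (γ ↦ γ • p))((1 ⊗ b) t) = (id ⊗ (γ ↦ γ • b • p))(t)`. [folklore] -/
theorem lTensor_smulInto_one_tmul_mul (p : P) (b : B) :
    (smulInto P p).lTensor B (((1 : B) ⊗ₜ[A] b) * t) = (smulInto P (b • p)).lTensor B t := by
  induction t using TensorProduct.induction_on with
  | zero => rw [mul_zero, map_zero, map_zero]
  | tmul β γ =>
    rw [Algebra.TensorProduct.tmul_mul_tmul, one_mul, LinearMap.lTensor_tmul,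
      LinearMap.lTensor_tmul]
    simp [LinearMap.toSpanSingleton_apply, mul_comm b γ, mul_smul]
  | add y z hy hz => rw [mul_add, map_add, map_add, hy, hz]

variable {t}

/-- **Remark 3.1** (`P ⊗_B η_x`): for `t = Σ bᵢ ⊗ cᵢ ∈ B ⊗_A B` with `(b ⊗ 1) t = (1 ⊗ b) t` for
all `b`, and a `B`-module `P`, the map `p ↦ Σ bᵢ ⊗ cᵢ p : P → B ⊗_A P` is `B`-LINEAR for the
`B`-structure on the left factor. [cite: IyengarTakahashi2014, Remark 3.1] -/
def etaTensor (ht : ∀ b : B, (b ⊗ₜ[A] (1 : B)) * t = ((1 : B) ⊗ₜ[A] b) * t) :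
    P →ₗ[B] B ⊗[A] P where
  toFun p := (smulInto P p).lTensor B t
  map_add' p q := by
    rw [← LinearMap.add_apply, ← LinearMap.lTensor_add]
    congr 2
    ext b
    simp
  map_smul' b p := by
    rw [RingHom.id_apply, ← lTensor_tmul_one_mul, ht b, lTensor_smulInto_one_tmul_mul]

/-- Pointwise formula for `etaTensor`. [cite: IyengarTakahashi2014, Remark 3.1] -/
theorem etaTensor_apply (ht : ∀ b : B, (b ⊗ₜ[A] (1 : B)) * t = ((1 : B) ⊗ₜ[A] b) * t) (p : P) :
    etaTensor P ht p = (smulInto P p).lTensor B t :=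
  rfl

/-- **Remark 3.1**, the factorisation `x = (P ⊗ μ) ∘ (P ⊗ η_x)`: composing `etaTensor` with an
`A`-linear `F : P → N` base-changed to `B ⊗_A P → N` evaluates, on a simple tensor level, to
`Σ bᵢ F(cᵢ p)`; in particular for `F = id` one recovers the homothety `μ(t)`. We record the
general evaluation against `F`. [cite: IyengarTakahashi2014, Remark 3.1] -/
theorem liftBaseChange_lTensor_smulInto {N : Type u} [AddCommGroup N] [Module A N] [Module B N]
    [IsScalarTower A B N] (F : P →ₗ[A] N) (p : P) (c : B) (n : N)
    (hF : ∀ γ : B, F (γ • p) = (γ * c) • n) :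
    F.liftBaseChange B ((smulInto P p).lTensor B t) =
      (Algebra.TensorProduct.lmul' (S := B) A t * c) • n := by
  induction t using TensorProduct.induction_on with
  | zero => rw [map_zero, map_zero, map_zero, zero_mul, zero_smul]
  | tmul β γ =>
    rw [LinearMap.lTensor_tmul, LinearMap.liftBaseChange_tmul, Algebra.TensorProduct.lmul'_apply_tmul]
    change β • F (γ • p) = _
    rw [hF, ← mul_smul, mul_assoc]
  | add y z hy hz => rw [map_add, map_add, hy, hz, map_add, add_mul, add_smul]

end Eta

end Ring

/-! ## Lemma 3.2 -/

section Lemma32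

variable {A : Type u} [CommRing A] {B : Type u} [CommRing B] [Algebra A B]

/-- **Lemma 3.2** ([IyengarTakahashi2014]; for commutative rings Wang 1994, Prop. 5.9): for
`B`-modules `M`, `N` there is an inclusion
`𝔑(B/A) · ann_A Ext¹_A(M, N) ⊆ ann_B Ext¹_B(M, N)`: if `x ∈ 𝔑(B/A)` and `a ∈ A` kills
`Ext¹_A(M, N)` (underlying `A`-modules, `ModuleCat.restrictScalars (algebraMap A B)`), then
`x · a` kills `Ext¹_B(M, N)`. [cite: IyengarTakahashi2014, Lemma 3.2] -/
theorem noetherDifferent_mul_smul_ext_eq_zero (M N : ModuleCat.{u} B) {x : B}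
    (hx : x ∈ noetherDifferent A B) {a : A}
    (ha : ∀ e : Ext.{u} ((ModuleCat.restrictScalars.{u} (algebraMap A B)).obj M)
      ((ModuleCat.restrictScalars.{u} (algebraMap A B)).obj N) 1, a • e = 0)
    (e : Ext.{u} M N 1) : (x * algebraMap A B a) • e = 0 := by
  obtain ⟨t, ht, rfl⟩ := hx
  set R := ModuleCat.restrictScalars.{u} (algebraMap A B) with hR
  -- a projective presentation `S : 0 → K → P → M → 0` over `B`; `e = δ f`
  obtain ⟨pres⟩ := EnoughProjectives.presentation (C := ModuleCat.{u} B) M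
  haveI := pres.projective
  haveI := pres.epi
  let S : ShortComplex (ModuleCat.{u} B) :=
    ShortComplex.mk (Limits.kernel.ι pres.f) pres.f (Limits.kernel.condition pres.f)
  have hS : S.ShortExact := { exact := ShortComplex.exact_kernel pres.f }
  haveI : Projective S.X₂ := pres.projective
  obtain ⟨f₀, rfl⟩ := precomp_extClass_surjective_of_projective_X₂ N hS 0 e
  obtain ⟨f, rfl⟩ := (Ext.mk₀_bijective _ _).2 f₀
  -- over `A`, `a f` extends to `F : P → N`
  have hSA := hS.map_of_exact R
  let fA : (S.map R).X₁ ⟶ R.obj N := R.map f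
  have h0 : hSA.extClass.comp (a • Ext.mk₀ fA) (add_zero 1) = 0 := by
    rw [Ext.comp_smul]
    exact ha _
  obtain ⟨F₀, hF₀⟩ := Ext.contravariant_sequence_exact₁ hSA (R.obj N) (a • Ext.mk₀ fA)
    (add_zero 1) h0
  obtain ⟨F, rfl⟩ := (Ext.mk₀_bijective _ _).2 F₀
  rw [Ext.mk₀_comp_mk₀, ← Ext.mk₀_smul] at hF₀
  have hF := (Ext.mk₀_bijective _ _).1 hF₀
  -- `hF : R.map S.f ≫ F = a • fA`, `fA = R.map f`, as `A`-linear maps (`a` acting through `B`)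
  let P : Type u := S.X₂
  let K : Type u := S.X₁
  letI : Module A P := Module.compHom P (algebraMap A B)
  letI : Module A N := Module.compHom N (algebraMap A B)
  haveI : IsScalarTower A B P := IsScalarTower.of_algebraMap_smul fun _ _ => rfl
  haveI : IsScalarTower A B N := IsScalarTower.of_algebraMap_smul fun _ _ => rfl
  let Fl : P →ₗ[A] N := F.hom
  have hFl : ∀ k : K, Fl (S.f.hom k) = algebraMap A B a • f.hom k := fun k => by
    have := congrArg (fun φ => φ.hom k) hF
    exact this
  -- the `B`-linear extension of `x a f`
  let F' : P →ₗ[B] N := (Fl.liftBaseChange B).comp (etaTensor P ht)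
  have hF' : S.f ≫ ModuleCat.ofHom F' =
      (Algebra.TensorProduct.lmul' (S := B) A t * algebraMap A B a) • f := by
    ext k
    change Fl.liftBaseChange B ((smulInto P (S.f.hom k)).lTensor B t) = _
    rw [liftBaseChange_lTensor_smulInto P Fl (S.f.hom k) (algebraMap A B a) (f.hom k)
      fun γ => by rw [← map_smul, hFl, map_smul, smul_smul, mul_comm]]
    rfl
  change _ • hS.extClass.comp (Ext.mk₀ f) (add_comm 1 0) = 0
  rw [← Ext.comp_smul, ← Ext.mk₀_smul, ← hF', ← Ext.mk₀_comp_mk₀]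
  exact hS.extClass_comp_assoc (Ext.mk₀ (ModuleCat.ofHom F'))

end Lemma32

end Literature.RingTheory.CohomologyAnnihilator

end
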